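import Summits.BirchSwinnertonDyer.Rank1Residual.F1Sign2.MultBranchEstimatesAtTwo
import Summits.BirchSwinnertonDyer.BirchSwinnertonDyer.Theorems.AnalyticMuZeroMultAtTwo.Negative.AnalyticMuZeroMultAtTwoFalseOfModularity
import HarnessLib

/-!
# F1Sign2 / RhombicBranchCongruenceHolds — the tree conjecture `RhombicBranchCongruence` is a THEOREM
(part 2 of 2; the `2`-adic estimates are in `MultBranchEstimatesAtTwo.lean`)
(cell `bsd-f1-sign2`, seat `-imc` g1; PROOF-ONLY module over the tree statements
`BranchCongruenceModTwoAtTwo.lean` p543248, `MultiplicativeAtTwoRepaired.lean`, and the proofs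
`RhombicSymbolCongruenceHolds.lean` p544233 (A♮sym) / `BranchCongruenceModTwoAtTwoHolds.lean` (§B, A♮L at
good ordinary odd level: `rhombicBranchCongruence_goodOrdinary`). No `def` of mathematical content; no
restatement.)

TURNKEY filing by the typer seat `bsd-f1-sign2-ty` (INBOX 2026-08-27T16:13/16:18Z, T-imc-4b-2 (F1Sign2ProofsC2.lean)): the
planner-of-record's kernel-checked file `HOME/MEMO-imc-data/F1Sign2ProofsC2.lean` sha16 30a58c6ec6cfb965 (split shape farm-checked in
`F1Sign2ProofsC_split_check.lean`: rc 0, 0 warnings, 0 sorries, standard axioms), re-filed VERBATIM (bib key spelling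
`CremonaAlgorithms1997`; §D's `frobeniusTrace_two_eq_zero_of_nonsplit` and `analyticMuZeroMultAtTwo_forbids_nonsplit` are taken
from REF1's landed refutation module p548567 instead of being re-declared — gate dedup on the first filing p550503). PROOF-ONLY module: no definition, no named fact. PARTITION: none moved.

It proves
* **A♮L at a MULTIPLICATIVE `2`** — `branchCongruenceModTwoMult_of_rhombic`: for a rational newform `f`
  with `2 ∥ N` and RHOMBIC period lattice and `a₂ = a₂(f) = ±1`, the one-term even branch
  `L₂⁺(f, a₂, ω⁰, T)` and odd branch `L₂⁻(f, a₂, ω¹, T)` both lie in `Λ₂` and are congruent mod `2Λ₂`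
  (`BranchCongruenceModTwoMult f a₂`);
* **`rhombicBranchCongruence_holds : RhombicBranchCongruence`** (both clauses) — closes the obligation
  node of p543248 BY NAME;
* `multBranchCongruenceAtTwoR_of_rhombicOfNegDisc : RhombicOfNegDisc → MultBranchCongruenceAtTwoR` and
  `oddEvenCongruenceMultAtTwoR_of_rhombicOfNegDisc_of_muZero : RhombicOfNegDisc → AnalyticMuZeroMultAtTwoR →
  (package uniqueness, displayed) → OddEvenCongruenceMultAtTwoR` (repaired currency);
* §D: kernel certificates for the audit recorded in `MultiplicativeAtTwoRepaired.lean` — with `α = 0` the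
  one-term branches vanish (`padicLFunctionPlusBranchMult_zero_alpha`, `…Minus…`), `frobeniusTrace 2 = 0`
  (non-split) / `= 2` (split) at a multiplicative `2`, `AnalyticMuZeroMultAtTwo` AS TYPED forbids every
  modular non-split-at-2 curve without rational `2`-torsion (`analyticMuZeroMultAtTwo_forbids_nonsplit`),
  and `MultBranchCongruenceAtTwo` AS TYPED is trivial on non-split rows.
Method (§C): the `Δ = {±1}`-doubling of both Riemann sums (`finsum_weighted_two_of_even` — evenness of the
one-term plus measure, `ratPlusSymbol_neg_val_div` — and the tree's `finsum_weighted_two_of_odd`); A♮sym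
(`rhombicSymbolCongruence_holds`) gives per cell `μ⁺ − μ⁻ = a₂^{−(n+2)}([1/2]⁺ + k_b)`, `k_b ∈ ℤ`; the offset
sums (hockey stick) to `a₂^{−(n+2)}[1/2]⁺·C(2ⁿ, k+1)`, and — the one new estimate versus §B, where the offset
carried a factor `(α − 1)` — `‖C(2ⁿ,k+1)‖₂·‖k+1‖₂ ≤ 2⁻ⁿ` (`(k+1)C(2ⁿ,k+1) = 2ⁿC(2ⁿ−1,k)`), so the offset is
EVENTUALLY `2`-integral whatever the fixed rational value `[1/2]⁺_f`; no bound on `[1/2]⁺_f`, hence no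
`E[2]`/torsion hypothesis, is needed. Then `‖[Tᵏ](L⁺ − L⁻)‖₂ ≤ 2⁻¹` for all `k` (`le_of_tendsto`),
integrality of `L⁻` (`exists_iwasawaToPowerSeries_eq_padicLFunctionMinusBranchMult_two`) transfers to `L⁺`
ultrametrically, and `iwasawaToPowerSeries_injective` gives `G − D ∈ 2Λ₂`. `a₂ = ±1` for `2 ∥ N`:
`IsNewform0.cuspCoeff_sq_eq_one_of_dvd_of_not_sq_dvd`; at curve level `a₂(f) = W.LFunction 2`:
`IsNewformOf.dvd_level_and_not_sq_dvd_of_multiplicative`.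
PLACEMENT (HOME/REF2-PLACEMENT-v4.md 2fa96cb621162658): the ingredients are in print — lattice types and
the cusp classes `0 ∼ 1/2` at `2 ∥ N` [cite: CremonaAlgorithms1997, §2.10; Lemma 2.2.3], the normalisation
`[r]^± = Re/Im λ(r)/Ω^±` with `Λ = ℤΩ⁺ ⊕ ℤ·½(Ω⁺ + Ω⁻ i)` for `Δ < 0` (C. Wuthrich, *Numerical modular symbols
for elliptic curves*, Math. Comp. 87 (2018), arXiv:1608.06423, §1 p. 2), the MSD measures and branches
[cite: MazurTateTeitelbaum1986Invent, §I.10–§I.13]; the mod-`2Λ₂` congruence of the two `2`-adic branches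
itself was not found in print as a sentence (REF2: «beyond print YES-small — analytic twin of
[cite: Matsuno2008, Thm 5.1], `D = −1 ⇔ Δ < 0`»). Axioms: propext, Classical.choice, Quot.sound
(combined farm check with §R/§B, -imc g1 folder `bc/proofsC_combined.lean`).
-/

set_option autoImplicit false

noncomputable section

open scoped Classical MatrixGroups ModularForm
open CongruenceSubgroup Polynomial
open Literature.NumberTheory.EllipticCurves Literature.NumberTheory.EllipticCurves.ModularForms
open Literature.NumberTheory.EllipticCurves.Greenberg1999
open Literature.NumberTheory.EllipticCurves.Rank1Residual
open Summit.BirchSwinnertonDyer.Rank1Residual.X1.MuLambda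
open Summit.BirchSwinnertonDyer.Rank1Residual.X5
open Summit.BirchSwinnertonDyer.BirchSwinnertonDyer.Theorems (AnalyticMuZeroMultAtTwoNegative.frobeniusTrace_two_eq_zero_of_nonsplit)

namespace Summit.BirchSwinnertonDyer.Rank1Residual.F1Sign2

/-! ## §C (part 2). A♮L at a MULTIPLICATIVE `2`: `BranchCongruenceModTwoMult f a₂` for rhombic `f`,
`rhombicBranchCongruence_holds`, and the curve-level repaired readings -/

section MultBranchCongruence

open Filter Topology

variable {N : ℕ} [NeZero N]

/-- **A♮L at a multiplicative `2` (THEOREM).** For a rational newform `f` with `2 ∥ N` and RHOMBIC period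
lattice, `a₂ = a₂(f)` (`= ±1`): the one-term even branch `L₂⁺(f, a₂, ω⁰, T)` and odd branch
`L₂⁻(f, a₂, ω¹, T)` both lie in `Λ₂` and are CONGRUENT mod `2Λ₂` — clause 2 of `RhombicBranchCongruence`. -/
theorem branchCongruenceModTwoMult_of_rhombic (f : CuspForm (Gamma0 N) 2) (hf : IsNewform0 f)
    (hQ : coeffField f = ⊥) (h2N : 2 ∣ N) (h4 : ¬ 4 ∣ N) (hrh : IsRhombic f) {a₂ : ℤ}
    (ha₂ : cuspCoeff f 2 = a₂) : BranchCongruenceModTwoMult f (a₂ : ℚ_[2]) := by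
  -- `a₂ = ±1`
  have h4' : ¬ 2 ^ 2 ∣ N := by norm_num; exact h4
  have hsq := hf.cuspCoeff_sq_eq_one_of_dvd_of_not_sq_dvd Nat.prime_two h2N h4'
  rw [ha₂] at hsq
  have hunit : a₂ = 1 ∨ a₂ = -1 := by
    have h1 : ((a₂ ^ 2 : ℤ) : ℂ) = ((1 : ℤ) : ℂ) := by push_cast; exact hsq
    exact sq_eq_one_iff.mp (by exact_mod_cast h1)
  have hα1 : ‖(a₂ : ℚ_[2])‖ = 1 := by rcases hunit with rfl | rfl <;> simp
  have hα0 : (a₂ : ℚ_[2]) ≠ 0 := fun h ↦ by rw [h, norm_zero] at hα1; exact zero_ne_one hα1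
  have hα : ‖(a₂ : ℚ_[2])⁻¹‖ ≤ 1 := by rw [norm_inv, hα1, inv_one]
  have hreal := cuspCoeff_im_eq_zero_of_coeffField_eq_bot hQ
  have hrat : ∀ r : ℚ, (ratPlusSymbol f r : ℝ) = normalizedPlusSymbol f r :=
    ratCast_ratPlusSymbol_holds hf hQ
  have hPM : PlusMinusSymbolCongruenceAtTwo f := rhombicSymbolCongruence_holds f hf hQ h4 hrh
  have hdistp : ∀ (n : ℕ) (a : ZMod (2 ^ n)),
      ∑ b ∈ Finset.univ.filter (fun b : ZMod (2 ^ (n + 1)) ↦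
        ZMod.castHom (pow_dvd_pow 2 n.le_succ) (ZMod (2 ^ n)) b = a),
          msdPlusMeasureMult f (a₂ : ℚ_[2]) (n + 1) b = msdPlusMeasureMult f (a₂ : ℚ_[2]) n a :=
    sum_fiber_msdPlusMeasureMult_succ_eq_of_coeffField (p := 2) hf hQ h2N ha₂ hα0
  have hdistm : ∀ (n : ℕ) (a : ZMod (2 ^ n)),
      ∑ b ∈ Finset.univ.filter (fun b : ZMod (2 ^ (n + 1)) ↦
        ZMod.castHom (pow_dvd_pow 2 n.le_succ) (ZMod (2 ^ n)) b = a),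
          msdMinusMeasureMult f (a₂ : ℚ_[2]) (n + 1) b = msdMinusMeasureMult f (a₂ : ℚ_[2]) n a :=
    sum_fiber_msdMinusMeasureMult_succ_eq_of_coeffField (p := 2) hf hQ h2N ha₂ hα0
  have hbp := norm_msdPlusMeasureMult_two_le f hrat hreal h2N h4 hα
  have hbm := norm_msdMinusMeasureMult_two_le_two f hreal h4 hα
  have hkey := norm_padicLMultCoeff_sub_le_half f hα hPM hdistp hdistm hbp hbm
  -- `L⁻` is integral (tree), hence so is `L⁺ = L⁻ + (L⁺ − L⁻)`
  obtain ⟨D, hD⟩ : ∃ D : IwasawaAlgebra 2,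
      iwasawaToPowerSeries 2 D = padicLFunctionMinusBranchMult f (a₂ : ℚ_[2]) 1 :=
    exists_iwasawaToPowerSeries_eq_padicLFunctionMinusBranchMult_two hf hQ h2N h4 ha₂ hunit odd_one
  have hDk : ∀ k, ‖padicLMinusBranchMultCoeff f (a₂ : ℚ_[2]) 1 k‖ ≤ 1 := fun k ↦ by
    have h := (exists_iwasawaToPowerSeries_eq_iff_norm_coeff_le_one _).mp ⟨D, hD⟩ k
    rwa [coeff_padicLFunctionMinusBranchMult] at h
  obtain ⟨G, hG⟩ : ∃ G : IwasawaAlgebra 2,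
      iwasawaToPowerSeries 2 G = padicLFunctionPlusBranchMult f (a₂ : ℚ_[2]) 0 :=
    (exists_iwasawaToPowerSeries_eq_iff_norm_coeff_le_one _).mpr fun k ↦ by
      rw [coeff_padicLFunctionPlusBranchMult]
      have e : padicLPlusBranchMultCoeff f (a₂ : ℚ_[2]) 0 k =
          (padicLPlusBranchMultCoeff f (a₂ : ℚ_[2]) 0 k - padicLMinusBranchMultCoeff f (a₂ : ℚ_[2]) 1 k) +
            padicLMinusBranchMultCoeff f (a₂ : ℚ_[2]) 1 k := by ring
      rw [e]
      exact (IsUltrametricDist.norm_add_le_max _ _).trans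
        (max_le ((hkey k).trans (by norm_num)) (hDk k))
  -- the half-difference is integral
  set L' : PowerSeries ℚ_[2] := PowerSeries.mk fun k ↦
    (padicLPlusBranchMultCoeff f (a₂ : ℚ_[2]) 0 k - padicLMinusBranchMultCoeff f (a₂ : ℚ_[2]) 1 k) / 2
    with hL'
  have h22 : ‖(2 : ℚ_[2])‖ = (2 : ℝ)⁻¹ := by simpa using Padic.norm_p (p := 2)
  obtain ⟨H, hH⟩ : ∃ H : IwasawaAlgebra 2, iwasawaToPowerSeries 2 H = L' :=
    (exists_iwasawaToPowerSeries_eq_iff_norm_coeff_le_one _).mpr fun k ↦ by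
      rw [hL', PowerSeries.coeff_mk, norm_div, h22, div_le_iff₀ (by norm_num), one_mul]
      exact hkey k
  refine ⟨G, D, hG, hD, H, ?_⟩
  apply iwasawaToPowerSeries_injective 2
  have hC2 : iwasawaToPowerSeries 2 (PowerSeries.C (2 : ℤ_[2])) = PowerSeries.C (2 : ℚ_[2]) := by
    show PowerSeries.map (algebraMap ℤ_[2] ℚ_[2]) (PowerSeries.C (2 : ℤ_[2])) = _
    rw [PowerSeries.map_C, map_ofNat]
  rw [map_sub, map_mul, hG, hD, hH, hC2]
  ext k
  rw [map_sub, coeff_padicLFunctionPlusBranchMult, coeff_padicLFunctionMinusBranchMult,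
    PowerSeries.coeff_C_mul, hL', PowerSeries.coeff_mk]
  ring

/-- **The tree conjecture `RhombicBranchCongruence` (p543248) is a THEOREM** — both clauses: good
ordinary odd `N` (§B, `rhombicBranchCongruence_goodOrdinary`) and multiplicative `2 ∥ N` (§C). -/
theorem rhombicBranchCongruence_holds : RhombicBranchCongruence := by
  intro N _ f a₂ hf hQ hrh ha₂
  exact ⟨fun h2N _ α hu hroot ↦ rhombicBranchCongruence_goodOrdinary f a₂ hf hQ hrh ha₂ h2N α hu hroot,
    fun h2N h4 ↦ branchCongruenceModTwoMult_of_rhombic f hf hQ h2N h4 hrh ha₂⟩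

/-- **Curve level, REPAIRED currency: `RhombicOfNegDisc → MultBranchCongruenceAtTwoR` (THEOREM modulo the
period-lattice shape fact).** `a₂(f) = a₂(E) = W.LFunction 2 = ±1` and `2 ∥ N` come from
`IsNewformOf.dvd_level_and_not_sq_dvd_of_multiplicative`. -/
theorem multBranchCongruenceAtTwoR_of_rhombicOfNegDisc (hR : RhombicOfNegDisc) :
    MultBranchCongruenceAtTwoR := by
  intro W _ _ hmult hΔ htor N _ f hf
  obtain ⟨h2N, h4', a, ha, -⟩ := hf.dvd_level_and_not_sq_dvd_of_multiplicative (p := 2) hmult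
  have h4 : ¬ 4 ∣ N := by norm_num at h4'; exact h4'
  have hLa : W.LFunction 2 = a := by
    have h := hf.2 2
    rw [ha] at h
    exact_mod_cast h.symm
  rw [hLa]
  exact branchCongruenceModTwoMult_of_rhombic f hf.1 hf.coeffField_eq_bot h2N h4 (hR W hΔ htor f hf) ha

/-- **Repaired B from K2μ(mult, repaired) and the lattice-shape fact (THEOREM):**
`RhombicOfNegDisc → AnalyticMuZeroMultAtTwoR → (package uniqueness `hu`, displayed) → OddEvenCongruenceMultAtTwoR`. -/
theorem oddEvenCongruenceMultAtTwoR_of_rhombicOfNegDisc_of_muZero (hR : RhombicOfNegDisc)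
    (hμ : AnalyticMuZeroMultAtTwoR)
    (hu : ∀ (W : WeierstrassCurve ℚ) [W.IsElliptic] [W.IsGloballyMinimal],
      W.HasMultiplicativeReductionAtPrime 2 → ∀ ⦃N : ℕ⦄ [NeZero N] (f : CuspForm (Gamma0 N) 2),
      IsNewformOf W f → MultPackageIsPlusBranch f ((W.LFunction 2 : ℤ) : ℚ_[2])) :
    OddEvenCongruenceMultAtTwoR :=
  oddEvenCongruenceMultR_of_modTwo_of_muZero (multBranchCongruenceAtTwoR_of_rhombicOfNegDisc hR) hμ hu

end MultBranchCongruence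

/-! ## §D. Kernel certificates for the audit of §R: the `frobeniusTrace`-typed readings are junk -/

section Audit

open Filter Topology

variable {N : ℕ}

/-- With `α = 0` the one-term plus measure vanishes at every positive level. -/
theorem msdPlusMeasureMult_zero_alpha (f : CuspForm (Gamma0 N) 2) {m : ℕ} (hm : m ≠ 0)
    (a : ZMod (2 ^ m)) : msdPlusMeasureMult f (0 : ℚ_[2]) m a = 0 := by
  simp [msdPlusMeasureMult, hm]

/-- With `α = 0` the one-term minus measure vanishes at every positive level. -/
theorem msdMinusMeasureMult_zero_alpha (f : CuspForm (Gamma0 N) 2) {m : ℕ} (hm : m ≠ 0)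
    (a : ZMod (2 ^ m)) : msdMinusMeasureMult f (0 : ℚ_[2]) m a = 0 := by
  simp [msdMinusMeasureMult, hm]

/-- With `α = 0` every Riemann sum of the one-term plus branch vanishes, so `L₂⁺(f, 0, ω^i, T) = 0`. -/
theorem padicLFunctionPlusBranchMult_zero_alpha (f : CuspForm (Gamma0 N) 2) (i : ℕ) :
    padicLFunctionPlusBranchMult f (0 : ℚ_[2]) i = 0 := by
  ext k
  rw [coeff_padicLFunctionPlusBranchMult, map_zero]
  have h : padicLPlusBranchMultRiemannSum f (0 : ℚ_[2]) i k = fun _ ↦ 0 := by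
    funext n
    unfold padicLPlusBranchMultRiemannSum
    refine finsum_eq_zero_of_forall_eq_zero fun ζ ↦ Finset.sum_eq_zero fun s _ ↦ ?_
    rw [msdPlusMeasureMult_zero_alpha f (by show n + 2 ≠ 0; omega), mul_zero, zero_mul]
  unfold padicLPlusBranchMultCoeff
  rw [h]
  exact tendsto_const_nhds.limUnder_eq

/-- With `α = 0` every Riemann sum of the one-term minus branch vanishes, so `L₂⁻(f, 0, ω^i, T) = 0`. -/
theorem padicLFunctionMinusBranchMult_zero_alpha (f : CuspForm (Gamma0 N) 2) (i : ℕ) :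
    padicLFunctionMinusBranchMult f (0 : ℚ_[2]) i = 0 := by
  ext k
  rw [coeff_padicLFunctionMinusBranchMult, map_zero]
  have h : padicLMinusBranchMultRiemannSum f (0 : ℚ_[2]) i k = fun _ ↦ 0 := by
    funext n
    unfold padicLMinusBranchMultRiemannSum
    refine finsum_eq_zero_of_forall_eq_zero fun ζ ↦ Finset.sum_eq_zero fun s _ ↦ ?_
    rw [msdMinusMeasureMult_zero_alpha f (by show n + 2 ≠ 0; omega), mul_zero, zero_mul]
  unfold padicLMinusBranchMultCoeff
  rw [h]
  exact tendsto_const_nhds.limUnder_eq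

/-- `BranchCongruenceModTwoMult f 0` holds trivially (`G = D = 0`): the `α = 0` instance is content-free. -/
theorem branchCongruenceModTwoMult_zero_alpha (f : CuspForm (Gamma0 N) 2) :
    BranchCongruenceModTwoMult f (0 : ℚ_[2]) :=
  ⟨0, 0, by rw [map_zero, padicLFunctionPlusBranchMult_zero_alpha],
    by rw [map_zero, padicLFunctionMinusBranchMult_zero_alpha], by simp⟩

/-- In the tree's currency `W.frobeniusTrace 2 = 2` at a SPLIT multiplicative `2` (`a₂(E) = 1`,
`frobeniusTrace = a₂(E) + 1`; the non-split twin `frobeniusTrace_two_eq_zero_of_nonsplit` and AUDIT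
CERTIFICATE 1 `analyticMuZeroMultAtTwo_forbids_nonsplit` are the landed copies in
`…Theorems.AnalyticMuZeroMultAtTwo.Negative.AnalyticMuZeroMultAtTwoFalseOfModularity` (p548567, REF1's
refutation of record), imported and not re-declared here). -/
theorem frobeniusTrace_two_eq_two_of_split (W : WeierstrassCurve ℚ) [W.IsElliptic]
    [W.IsGloballyMinimal] (hm : W.HasMultiplicativeReductionAtPrime 2)
    (hs : W.HasSplitMultiplicativeReductionAtPrime 2) : W.frobeniusTrace 2 = 2 := by
  have h1 := W.LFunction_apply_prime_eq_frobeniusTrace_sub_one_of_hasMultiplicativeReductionAtPrime 2 hm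
  have h2 := W.LFunction_apply_prime_of_hasSplitMultiplicativeReductionAtPrime 2 hs
  omega

/-- **AUDIT CERTIFICATE 2.** `MultBranchCongruenceAtTwo` AS TYPED holds trivially on every NON-SPLIT row
(its `α` is `0` there), independently of the curve. -/
theorem multBranchCongruenceAtTwo_nonsplit_trivial (W : WeierstrassCurve ℚ) [W.IsElliptic]
    [W.IsGloballyMinimal] (hm : W.HasMultiplicativeReductionAtPrime 2)
    (hns : ¬ W.HasSplitMultiplicativeReductionAtPrime 2) ⦃N : ℕ⦄ (f : CuspForm (Gamma0 N) 2) :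
    BranchCongruenceModTwoMult f (W.frobeniusTrace 2 : ℚ_[2]) := by
  rw [AnalyticMuZeroMultAtTwoNegative.frobeniusTrace_two_eq_zero_of_nonsplit W hm hns, Int.cast_zero]
  exact branchCongruenceModTwoMult_zero_alpha f

end Audit

end Summit.BirchSwinnertonDyer.Rank1Residual.F1Sign2
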